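import Literature.Geometry.Kaehler.HypersurfaceExtension
import Literature.Analysis.Complex.SmoothHypersurfaceDivision
import HarnessLib

/-!
# The ideal of a linear slice of a convex domain: `f = 0` on `{ℓ₁ = ⋯ = ℓ_k = 0}` forces `f = Σ ℓᵢ gᵢ`

H. Cartan's Théorème B for the Koszul complex of `k` independent linear coordinates on a convex
open set, in the elementary form needed by Serre's dimension count in dimension `n` (J.-P. Serre,
*GAGA* (1956) n° 16 Lemme 8 / *FAC* (1955) n° 81: the hyperplane sections `t₀, …, t_{n-1}` of the
flag form a REGULAR SEQUENCE on the sections over the members of the cover, and the ideal of their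
common zero set is `(t₀, …, t_{n-1})`); K. Fritzsche, H. Grauert, *From Holomorphic Functions to
Complex Manifolds* (2002), Ch. V §3 ("if `A = {f₁ = ⋯ = f_k = 0}` with `(f₁, …, f_k)` of rank `k`,
every holomorphic function vanishing on `A` is a combination `Σ fᵢ gᵢ`", on Stein sets). After a
holomorphic straightening (`exists_holStraightening`) the `tᵢ` ARE continuous linear functionals
`ℓᵢ`, and the tree's degree-one theorems — division by one reduced equation
(`SCV.exists_eq_smul_of_eqOn_zero`, `SmoothHypersurfaceDivision`) and extension from one smooth
hypersurface of a convex open set (`exists_differentiableOn_forall_eq_of_local`,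
`HypersurfaceExtension`, Cousin I) — give the `k`-fold statements by induction on `k` through the
hyperplane `ker ℓ_{j₀}` (itself a finite-dimensional space, with the convex slice of `Ω`):

* `exists_eq_sum_mul_of_forall_eq_zero` — **the ideal of a linear slice**: for `Ω` convex open in a
  finite-dimensional complex normed space, continuous linear functionals `ℓᵢ` (`i ∈ J`, a finset)
  admitting dual vectors `eⱼ` (`ℓᵢ(eⱼ) = δᵢⱼ`), and `f` holomorphic on `Ω` vanishing on
  `Ω ∩ {ℓᵢ = 0, i ∈ J}`, there are `gᵢ` holomorphic on `Ω` with `f = Σ_{i ∈ J} ℓᵢ · gᵢ` on `Ω`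
  (restrict to `ker ℓ_{j₀}`, induct, extend the coefficients to `Ω`, divide the remainder by `ℓ_{j₀}`);
* `eq_zero_of_forall_eq_zero_of_mul_eq_sum_mul` / `exists_eq_sum_mul_of_mul_eq_sum_mul` —
  **`(ℓᵢ)_{i ∈ J}, ℓ_{j₁}` is a regular sequence on `𝒪(Ω)`**: if `ℓ_{j₁} f ∈ (ℓᵢ)_{i∈J} 𝒪(Ω)` (with
  ARBITRARY coefficient functions) then `f` vanishes on the slice (move off `{ℓ_{j₁} = 0}` inside the
  slice along `e_{j₁}` and pass to the limit), hence `f ∈ (ℓᵢ)_{i∈J} 𝒪(Ω)`;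
* `exists_eq_sum_mul_sub_of_forall_eq_zero`, `exists_eq_sum_mul_sub_of_mul_eq_sum_mul` — the same
  for the affine slices `{ℓᵢ(· - a) = 0}` (translation).

These are the inputs `regular` (for `i ≥ 2`) and `ker ev ⊆ Σ im tⱼ` of the flag tower
`Literature.Algebra.Homology.NatCochain.FlagTower` (file `Algebra/Homology/NatCochainFlagCount`) in
dimension `n ≥ 3`, where the intermediate slices have positive dimension (for a transversal PAIR on a
surface the tree has `SCV.exists_eq_smul_of_mul_eq_mul` and
`exists_eq_add_mul_of_eqOn_zero_of_finrank_eq_two`). Everything is proved; theorems only.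

## References

* K. Fritzsche, H. Grauert, *From Holomorphic Functions to Complex Manifolds*, GTM 213 (2002),
  Ch. V §1 Prop. 1.6, §3. [FritzscheGrauert2002]
* J.-P. Serre, *Géométrie algébrique et géométrie analytique*, Ann. Inst. Fourier 6 (1956), n° 16
  Lemme 8. [SerreGAGA1956]
* E. M. Chirka, *Complex Analytic Sets* (1989), §2.8 and A1.1. [Chirka1989]
-/

noncomputable section

open scoped Topology
open Set Filter Literature.Analysis.Complex

namespace Literature.Geometry.Kaehler

universe u v

variable {κ : Type v} [DecidableEq κ]

/-! ### The ideal of a linear slice through the origin -/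

/-- **The ideal of a linear slice of a convex domain** (Cartan's Theorem B for the Koszul complex of
independent linear coordinates, elementary form). Let `Ω` be a convex open subset of a
finite-dimensional complex normed space `E`, `J` a finite set of indices, `ℓᵢ : E →L[ℂ] ℂ` with dual
vectors `eⱼ` (`ℓᵢ(eⱼ) = δᵢⱼ` for `i, j ∈ J`), and `f` holomorphic on `Ω` with `f = 0` on
`Ω ∩ {z | ℓᵢ z = 0 for all i ∈ J}`. Then `f = Σ_{i ∈ J} ℓᵢ · gᵢ` on `Ω` for some `gᵢ` holomorphic on
`Ω`. Induction on `#J` through the hyperplane `ker ℓ_{j₀}`: the restriction of `f` lies in the ideal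
of the remaining coordinates there; the coefficients extend holomorphically to `Ω`
(`exists_differentiableOn_forall_eq_of_local`); the remainder vanishes on `Ω ∩ ker ℓ_{j₀}` and is
divisible by `ℓ_{j₀}` (`SCV.exists_eq_smul_of_eqOn_zero`). Induction form, on `n = #J`; see
`exists_eq_sum_mul_of_forall_eq_zero`.
[cite: FritzscheGrauert2002, Ch. V §1 Prop. 1.6 and §3] [cite: SerreGAGA1956, n° 16 Lemme 8] -/
theorem exists_eq_sum_mul_of_forall_eq_zero_card :
    ∀ (n : ℕ) {E : Type u} [NormedAddCommGroup E] [NormedSpace ℂ E] [FiniteDimensional ℂ E]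
      (J : Finset κ), J.card = n → ∀ (ℓ : κ → E →L[ℂ] ℂ) (e : κ → E),
      (∀ i ∈ J, ∀ j ∈ J, ℓ i (e j) = if i = j then 1 else 0) →
      ∀ {Ω : Set E}, IsOpen Ω → Convex ℝ Ω → ∀ {f : E → ℂ}, DifferentiableOn ℂ f Ω →
      (∀ z ∈ Ω, (∀ i ∈ J, ℓ i z = 0) → f z = 0) →
      ∃ g : κ → E → ℂ, (∀ i, DifferentiableOn ℂ (g i) Ω) ∧
        ∀ z ∈ Ω, f z = ∑ i ∈ J, ℓ i z * g i z := by
  intro n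
  induction n with
  | zero =>
    intro E _ _ _ J hJ ℓ e _ Ω _ _ f _ hf0
    rw [Finset.card_eq_zero] at hJ
    subst hJ
    exact ⟨fun _ _ ↦ 0, fun _ ↦ differentiableOn_const 0, fun z hz ↦ by
      rw [Finset.sum_empty]; exact hf0 z hz (by simp)⟩
  | succ n ih =>
    intro E _ _ _ J hJ ℓ e hdual Ω hΩo hΩc f hf hf0
    obtain ⟨j₀, hj₀⟩ : J.Nonempty := Finset.card_pos.1 (by omega)
    set J' : Finset κ := J.erase j₀ with hJ'def
    have hJ' : J'.card = n := by rw [Finset.card_erase_of_mem hj₀, hJ, Nat.add_sub_cancel]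
    have hJ'sub : ∀ i ∈ J', i ∈ J := fun i hi ↦ Finset.mem_of_mem_erase hi
    have hJ'ne : ∀ i ∈ J', i ≠ j₀ := fun i hi ↦ Finset.ne_of_mem_erase hi
    -- `ℓ j₀ ≠ 0` and its derivative
    have hℓe : ℓ j₀ (e j₀) = 1 := by rw [hdual j₀ hj₀ j₀ hj₀, if_pos rfl]
    have hℓ0 : ℓ j₀ ≠ 0 := fun h ↦ by rw [h] at hℓe; simp at hℓe
    have hdt : ∀ x ∈ Ω, ℓ j₀ x = 0 → fderiv ℂ (fun z ↦ ℓ j₀ z) x ≠ 0 := fun x _ _ ↦ by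
      rw [show (fun z ↦ ℓ j₀ z) = ⇑(ℓ j₀) from rfl, ContinuousLinearMap.fderiv]; exact hℓ0
    -- the hyperplane `H = ker ℓ j₀` and the projection `π` onto it along `e j₀`
    set H : Submodule ℂ E := LinearMap.ker (ℓ j₀ : E →ₗ[ℂ] ℂ) with hHdef
    have hmemH : ∀ {z : E}, z ∈ H ↔ ℓ j₀ z = 0 := fun {z} ↦ by rw [hHdef, LinearMap.mem_ker]; rfl
    let ι : H →L[ℂ] E := H.subtypeL
    have hπmem : ∀ z : E, (ContinuousLinearMap.id ℂ E - (ℓ j₀).smulRight (e j₀)) z ∈ H := fun z ↦ by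
      rw [hmemH]
      simp [hℓe]
    let π : E →L[ℂ] H := (ContinuousLinearMap.id ℂ E - (ℓ j₀).smulRight (e j₀)).codRestrict H hπmem
    have hπ : ∀ z : E, (π z : E) = z - ℓ j₀ z • e j₀ := fun z ↦ rfl
    have hπH : ∀ z : E, ℓ j₀ z = 0 → (π z : E) = z := fun z hz ↦ by rw [hπ, hz, zero_smul, sub_zero]
    -- the induction hypothesis on `H`
    let ℓ' : κ → H →L[ℂ] ℂ := fun i ↦ (ℓ i).comp ι
    have he' : ∀ i ∈ J', e i ∈ H := fun i hi ↦ by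
      rw [hmemH, hdual j₀ hj₀ i (hJ'sub i hi), if_neg (hJ'ne i hi).symm]
    let e' : κ → H := fun i ↦ if h : i ∈ J' then ⟨e i, he' i h⟩ else 0
    have hdual' : ∀ i ∈ J', ∀ j ∈ J', ℓ' i (e' j) = if i = j then 1 else 0 := fun i hi j hj ↦ by
      simp only [ℓ', e', dif_pos hj, ContinuousLinearMap.comp_apply, ι, Submodule.subtypeL_apply]
      exact hdual i (hJ'sub i hi) j (hJ'sub j hj)
    set Ω' : Set H := ι ⁻¹' Ω with hΩ'def
    have hΩ'o : IsOpen Ω' := hΩo.preimage ι.continuous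
    have hΩ'c : Convex ℝ Ω' := hΩc.linear_preimage (ι.toLinearMap.restrictScalars ℝ)
    have hf' : DifferentiableOn ℂ (f ∘ ι) Ω' := hf.comp ι.differentiableOn (mapsTo_preimage ι Ω)
    have hf0' : ∀ x ∈ Ω', (∀ i ∈ J', ℓ' i x = 0) → (f ∘ ι) x = 0 := fun x hx h0 ↦ by
      refine hf0 (ι x) hx fun i hi ↦ ?_
      by_cases hij : i = j₀
      · subst hij
        exact hmemH.1 x.2
      · exact h0 i (Finset.mem_erase.2 ⟨hij, hi⟩)
    obtain ⟨g', hg', hfg'⟩ := ih (E := H) J' hJ' ℓ' e' hdual' hΩ'o hΩ'c hf' hf0'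
    -- extend the coefficients from the hyperplane to `Ω`
    have hext : ∀ i ∈ J', ∃ G : E → ℂ, DifferentiableOn ℂ G Ω ∧
        ∀ z ∈ Ω, ℓ j₀ z = 0 → G z = g' i (π z) := fun i hi ↦ by
      refine exists_differentiableOn_forall_eq_of_local hΩo hΩc (t := fun z ↦ ℓ j₀ z)
        (ℓ j₀).differentiableOn hdt (f := fun z ↦ g' i (π z)) fun y hy hy0 ↦ ?_
      refine ⟨Ω ∩ π ⁻¹' Ω', hΩo.inter (hΩ'o.preimage π.continuous), ⟨hy, ?_⟩, inter_subset_left,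
        fun z ↦ g' i (π z), ?_, fun _ _ _ ↦ rfl⟩
      · show (ι (π y)) ∈ Ω
        rw [show ι (π y) = (π y : E) from rfl, hπH y hy0]
        exact hy
      · exact (hg' i).comp π.differentiableOn fun z hz ↦ hz.2
    choose! G hG hGg using hext
    -- the remainder vanishes on the hyperplane and is divisible by `ℓ j₀`
    set R : E → ℂ := fun z ↦ f z - ∑ i ∈ J', ℓ i z * G i z with hRdef
    have hR : DifferentiableOn ℂ R Ω :=
      hf.sub (DifferentiableOn.fun_sum fun i hi ↦ ((ℓ i).differentiableOn).mul (hG i hi))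
    have hR0 : ∀ z ∈ Ω, ℓ j₀ z = 0 → R z = 0 := fun z hz hz0 ↦ by
      have hxΩ : (⟨z, hmemH.2 hz0⟩ : H) ∈ Ω' := hz
      have h := hfg' ⟨z, hmemH.2 hz0⟩ hxΩ
      have hπz : π z = ⟨z, hmemH.2 hz0⟩ := Subtype.ext (hπH z hz0)
      simp only [hRdef, sub_eq_zero]
      rw [show f z = (f ∘ ι) ⟨z, hmemH.2 hz0⟩ from rfl, h]
      refine Finset.sum_congr rfl fun i hi ↦ ?_
      rw [hGg i hi z hz hz0, hπz]
      rfl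
    obtain ⟨G₀, hG₀, hRG₀⟩ := SCV.exists_eq_smul_of_eqOn_zero hΩo (t := fun z ↦ ℓ j₀ z)
      (ℓ j₀).differentiableOn hR hdt hR0
    -- assemble
    refine ⟨fun i ↦ if i = j₀ then G₀ else if i ∈ J' then G i else fun _ ↦ 0, fun i ↦ ?_,
      fun z hz ↦ ?_⟩
    · by_cases hi : i = j₀
      · simp only [hi, if_true]; exact hG₀
      · by_cases hi' : i ∈ J'
        · simp only [hi, hi', if_false, if_true]; exact hG i hi'
        · simp only [hi, hi', if_false]; exact differentiableOn_const 0
    · rw [← Finset.add_sum_erase J _ hj₀, ← hJ'def]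
      dsimp only
      rw [if_pos rfl]
      have hsum : ∑ i ∈ J', ℓ i z * (if i = j₀ then G₀ else if i ∈ J' then G i else fun _ ↦ 0) z =
          ∑ i ∈ J', ℓ i z * G i z :=
        Finset.sum_congr rfl fun i hi ↦ by rw [if_neg (hJ'ne i hi), if_pos hi]
      rw [hsum]
      have h := hRG₀ z hz
      simp only [hRdef, smul_eq_mul] at h
      linear_combination h

/-- **The ideal of a linear slice of a convex domain**: for `Ω` convex open in a finite-dimensional
complex normed space, continuous linear functionals `ℓᵢ` (`i ∈ J`) with dual vectors `eⱼ`
(`ℓᵢ(eⱼ) = δᵢⱼ` on `J`), every `f` holomorphic on `Ω` vanishing on `Ω ∩ {ℓᵢ = 0, i ∈ J}` writes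
`f = Σ_{i ∈ J} ℓᵢ · gᵢ` with `gᵢ` holomorphic on `Ω` — exactness of the Koszul-type sequence
`𝒪ᴶ → 𝒪 → 𝒪_{slice} → 0` on sections over `Ω`.
[cite: FritzscheGrauert2002, Ch. V §1 Prop. 1.6 and §3] [cite: SerreGAGA1956, n° 16 Lemme 8] -/
theorem exists_eq_sum_mul_of_forall_eq_zero {E : Type u} [NormedAddCommGroup E] [NormedSpace ℂ E]
    [FiniteDimensional ℂ E] (J : Finset κ) (ℓ : κ → E →L[ℂ] ℂ) (e : κ → E)
    (hdual : ∀ i ∈ J, ∀ j ∈ J, ℓ i (e j) = if i = j then 1 else 0)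
    {Ω : Set E} (hΩo : IsOpen Ω) (hΩc : Convex ℝ Ω) {f : E → ℂ} (hf : DifferentiableOn ℂ f Ω)
    (hf0 : ∀ z ∈ Ω, (∀ i ∈ J, ℓ i z = 0) → f z = 0) :
    ∃ g : κ → E → ℂ, (∀ i, DifferentiableOn ℂ (g i) Ω) ∧ ∀ z ∈ Ω, f z = ∑ i ∈ J, ℓ i z * g i z :=
  exists_eq_sum_mul_of_forall_eq_zero_card J.card J rfl ℓ e hdual hΩo hΩc hf hf0

/-! ### Regular sequences of linear coordinates -/

omit [DecidableEq κ] in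
/-- **Off the last hyperplane, inside the slice**: if `ℓ_{j₁} · f = Σ_{i ∈ J} ℓᵢ · qᵢ` on `Ω` (any
coefficient functions `qᵢ`), `j₁ ∉ J`, `ℓᵢ(e_{j₁}) = 0` for `i ∈ J` and `ℓ_{j₁}(e_{j₁}) = 1`, then the
continuous `f` vanishes on the slice `Ω ∩ {ℓᵢ = 0, i ∈ J}`: at a slice point `z` with `ℓ_{j₁} z = 0`
the points `z + s e_{j₁}` (`s → 0`, `s ≠ 0`) stay in the slice with `ℓ_{j₁} ≠ 0`, so `f` vanishes
there and at `z` by continuity. [cite: SerreGAGA1956, n° 16 Lemme 8] [cite: Chirka1989, §2.8] -/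
theorem eq_zero_of_forall_eq_zero_of_mul_eq_sum_mul {E : Type u} [NormedAddCommGroup E]
    [NormedSpace ℂ E] (J : Finset κ) {j₁ : κ} (ℓ : κ → E →L[ℂ] ℂ) (e₁ : E)
    (he₁ : ∀ i ∈ J, ℓ i e₁ = 0) (hℓ₁ : ℓ j₁ e₁ = 1) {Ω : Set E} (hΩo : IsOpen Ω) {f : E → ℂ}
    (hf : ContinuousOn f Ω) {q : κ → E → ℂ} (hq : ∀ z ∈ Ω, ℓ j₁ z * f z = ∑ i ∈ J, ℓ i z * q i z)
    {z : E} (hz : z ∈ Ω) (hz0 : ∀ i ∈ J, ℓ i z = 0) : f z = 0 := by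
  -- on the slice, `ℓ_{j₁} w ≠ 0` forces `f w = 0`
  have key : ∀ w ∈ Ω, (∀ i ∈ J, ℓ i w = 0) → ℓ j₁ w ≠ 0 → f w = 0 := fun w hw hw0 hw1 ↦ by
    have h := hq w hw
    rw [Finset.sum_eq_zero fun i hi ↦ by rw [hw0 i hi, zero_mul]] at h
    exact (mul_eq_zero.1 h).resolve_left hw1
  by_cases h1 : ℓ j₁ z ≠ 0
  · exact key z hz hz0 h1
  rw [not_ne_iff] at h1
  -- the curve `s ↦ z + s • e₁`
  have hγ : Continuous fun s : ℂ ↦ z + s • e₁ := by fun_prop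
  have hγ0 : (fun s : ℂ ↦ z + s • e₁) 0 = z := by simp
  have htend : Tendsto (fun s : ℂ ↦ f (z + s • e₁)) (𝓝[≠] 0) (𝓝 (f z)) := by
    have hc : ContinuousAt f z := hf.continuousAt (hΩo.mem_nhds hz)
    have h := hc.tendsto.comp (by simpa [hγ0] using hγ.continuousAt (x := (0 : ℂ)) |>.tendsto)
    exact h.mono_left nhdsWithin_le_nhds
  have hev : ∀ᶠ s : ℂ in 𝓝[≠] 0, f (z + s • e₁) = 0 := by
    have hΩev : ∀ᶠ s : ℂ in 𝓝 0, z + s • e₁ ∈ Ω := by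
      refine hγ.continuousAt.preimage_mem_nhds ?_
      simp only [zero_smul, add_zero]
      exact hΩo.mem_nhds hz
    filter_upwards [mem_nhdsWithin_of_mem_nhds hΩev, self_mem_nhdsWithin] with s hs hs0
    refine key _ hs (fun i hi ↦ ?_) ?_
    · rw [map_add, map_smul, hz0 i hi, he₁ i hi, smul_zero, add_zero]
    · rw [map_add, map_smul, h1, hℓ₁, smul_eq_mul, mul_one, zero_add]
      exact hs0
  have h0 : Tendsto (fun s : ℂ ↦ f (z + s • e₁)) (𝓝[≠] 0) (𝓝 0) :=
    tendsto_const_nhds.congr' (hev.mono fun s hs ↦ hs.symm)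
  exact tendsto_nhds_unique htend h0

/-- **Independent linear coordinates form a regular sequence on `𝒪(Ω)`, `Ω` convex**: with `Ω`,
`ℓ`, `e` as in `exists_eq_sum_mul_of_forall_eq_zero` for the index set `insert j₁ J` (`j₁ ∉ J`), if
`f` is holomorphic on `Ω` and `ℓ_{j₁} · f = Σ_{i ∈ J} ℓᵢ · qᵢ` for SOME functions `qᵢ`, then
`f = Σ_{i ∈ J} ℓᵢ · gᵢ` with `gᵢ` holomorphic on `Ω` — the injectivity of multiplication by `ℓ_{j₁}` on
`𝒪(Ω)/(ℓᵢ)_{i ∈ J}`, i.e. the field `regular` of a flag tower of Čech complexes.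
[cite: SerreGAGA1956, n° 16 Lemme 8] [cite: FritzscheGrauert2002, Ch. V §3] -/
theorem exists_eq_sum_mul_of_mul_eq_sum_mul {E : Type u} [NormedAddCommGroup E] [NormedSpace ℂ E]
    [FiniteDimensional ℂ E] (J : Finset κ) {j₁ : κ} (hj₁ : j₁ ∉ J) (ℓ : κ → E →L[ℂ] ℂ) (e : κ → E)
    (hdual : ∀ i ∈ insert j₁ J, ∀ j ∈ insert j₁ J, ℓ i (e j) = if i = j then 1 else 0)
    {Ω : Set E} (hΩo : IsOpen Ω) (hΩc : Convex ℝ Ω) {f : E → ℂ} (hf : DifferentiableOn ℂ f Ω)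
    {q : κ → E → ℂ} (hq : ∀ z ∈ Ω, ℓ j₁ z * f z = ∑ i ∈ J, ℓ i z * q i z) :
    ∃ g : κ → E → ℂ, (∀ i, DifferentiableOn ℂ (g i) Ω) ∧ ∀ z ∈ Ω, f z = ∑ i ∈ J, ℓ i z * g i z := by
  refine exists_eq_sum_mul_of_forall_eq_zero J ℓ e
    (fun i hi j hj ↦ hdual i (Finset.mem_insert_of_mem hi) j (Finset.mem_insert_of_mem hj)) hΩo hΩc hf
    fun z hz hz0 ↦ ?_
  refine eq_zero_of_forall_eq_zero_of_mul_eq_sum_mul J ℓ (e j₁) (fun i hi ↦ ?_) ?_ hΩo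
    hf.continuousOn hq hz hz0
  · rw [hdual i (Finset.mem_insert_of_mem hi) j₁ (Finset.mem_insert_self _ _),
      if_neg (ne_of_mem_of_not_mem hi hj₁)]
  · rw [hdual j₁ (Finset.mem_insert_self _ _) j₁ (Finset.mem_insert_self _ _), if_pos rfl]

/-! ### Affine slices -/

/-- **The ideal of an affine linear slice** `Ω ∩ {ℓᵢ(· - a) = 0, i ∈ J}` of a convex open `Ω`: a
holomorphic `f` vanishing there writes `f z = Σ_{i ∈ J} ℓᵢ(z - a) · gᵢ z` with `gᵢ` holomorphic on
`Ω` (translation of `exists_eq_sum_mul_of_forall_eq_zero`).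
[cite: FritzscheGrauert2002, Ch. V §1 Prop. 1.6 and §3] -/
theorem exists_eq_sum_mul_sub_of_forall_eq_zero {E : Type u} [NormedAddCommGroup E]
    [NormedSpace ℂ E] [FiniteDimensional ℂ E] (J : Finset κ) (ℓ : κ → E →L[ℂ] ℂ) (e : κ → E)
    (hdual : ∀ i ∈ J, ∀ j ∈ J, ℓ i (e j) = if i = j then 1 else 0) (a : E)
    {Ω : Set E} (hΩo : IsOpen Ω) (hΩc : Convex ℝ Ω) {f : E → ℂ} (hf : DifferentiableOn ℂ f Ω)
    (hf0 : ∀ z ∈ Ω, (∀ i ∈ J, ℓ i (z - a) = 0) → f z = 0) :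
    ∃ g : κ → E → ℂ, (∀ i, DifferentiableOn ℂ (g i) Ω) ∧
      ∀ z ∈ Ω, f z = ∑ i ∈ J, ℓ i (z - a) * g i z := by
  -- translate: `Ω₀ = Ω - a`, `f₀ = f (· + a)`
  set τ : E → E := fun w ↦ w + a with hτ
  have hτc : Continuous τ := by fun_prop
  set Ω₀ : Set E := τ ⁻¹' Ω with hΩ₀
  have hΩ₀o : IsOpen Ω₀ := hΩo.preimage hτc
  have hΩ₀c : Convex ℝ Ω₀ := by
    have : Ω₀ = (fun w ↦ a + w) ⁻¹' Ω := by ext w; simp [hΩ₀, hτ, add_comm]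
    rw [this]
    exact hΩc.translate_preimage_right a
  have hf₀ : DifferentiableOn ℂ (f ∘ τ) Ω₀ :=
    hf.comp ((differentiable_id.add_const a).differentiableOn) (mapsTo_preimage τ Ω)
  have hf₀0 : ∀ w ∈ Ω₀, (∀ i ∈ J, ℓ i w = 0) → (f ∘ τ) w = 0 := fun w hw hw0 ↦
    hf0 (τ w) hw fun i hi ↦ by simpa [hτ] using hw0 i hi
  obtain ⟨g₀, hg₀, hfg₀⟩ :=
    exists_eq_sum_mul_of_forall_eq_zero J ℓ e hdual hΩ₀o hΩ₀c hf₀ hf₀0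
  refine ⟨fun i z ↦ g₀ i (z - a), fun i ↦ ?_, fun z hz ↦ ?_⟩
  · have hm : MapsTo (fun z : E ↦ z - a) Ω Ω₀ := fun z hz ↦ by
      show (z - a) + a ∈ Ω
      rwa [sub_add_cancel]
    exact (hg₀ i).comp ((differentiable_id.sub_const a).differentiableOn) hm
  · have hz₀ : z - a ∈ Ω₀ := by show (z - a) + a ∈ Ω; rwa [sub_add_cancel]
    have h := hfg₀ (z - a) hz₀
    simp only [Function.comp_apply, hτ, sub_add_cancel] at h
    exact h

/-- **Regular sequence, affine form**: if `ℓ_{j₁}(· - a) · f = Σ_{i ∈ J} ℓᵢ(· - a) · qᵢ` on the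
convex open `Ω` (`j₁ ∉ J`, dual vectors as in `exists_eq_sum_mul_of_mul_eq_sum_mul`), then
`f = Σ_{i ∈ J} ℓᵢ(· - a) · gᵢ` with `gᵢ` holomorphic on `Ω`. [cite: SerreGAGA1956, n° 16 Lemme 8] -/
theorem exists_eq_sum_mul_sub_of_mul_eq_sum_mul {E : Type u} [NormedAddCommGroup E]
    [NormedSpace ℂ E] [FiniteDimensional ℂ E] (J : Finset κ) {j₁ : κ} (hj₁ : j₁ ∉ J)
    (ℓ : κ → E →L[ℂ] ℂ) (e : κ → E)
    (hdual : ∀ i ∈ insert j₁ J, ∀ j ∈ insert j₁ J, ℓ i (e j) = if i = j then 1 else 0) (a : E)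
    {Ω : Set E} (hΩo : IsOpen Ω) (hΩc : Convex ℝ Ω) {f : E → ℂ} (hf : DifferentiableOn ℂ f Ω)
    {q : κ → E → ℂ} (hq : ∀ z ∈ Ω, ℓ j₁ (z - a) * f z = ∑ i ∈ J, ℓ i (z - a) * q i z) :
    ∃ g : κ → E → ℂ, (∀ i, DifferentiableOn ℂ (g i) Ω) ∧
      ∀ z ∈ Ω, f z = ∑ i ∈ J, ℓ i (z - a) * g i z := by
  refine exists_eq_sum_mul_sub_of_forall_eq_zero J ℓ e
    (fun i hi j hj ↦ hdual i (Finset.mem_insert_of_mem hi) j (Finset.mem_insert_of_mem hj)) a hΩo hΩc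
    hf fun z hz hz0 ↦ ?_
  -- translate the regularity lemma
  set τ : E → E := fun w ↦ w + a with hτ
  have hτc : Continuous τ := by fun_prop
  have hΩ₀o : IsOpen (τ ⁻¹' Ω) := hΩo.preimage hτc
  have hfc : ContinuousOn (f ∘ τ) (τ ⁻¹' Ω) := hf.continuousOn.comp hτc.continuousOn (mapsTo_preimage τ Ω)
  have hq₀ : ∀ w ∈ τ ⁻¹' Ω, ℓ j₁ w * (f ∘ τ) w = ∑ i ∈ J, ℓ i w * (fun i w ↦ q i (τ w)) i w :=
    fun w hw ↦ by simpa [hτ] using hq (τ w) hw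
  have hz₀ : z - a ∈ τ ⁻¹' Ω := by show (z - a) + a ∈ Ω; rwa [sub_add_cancel]
  have h := eq_zero_of_forall_eq_zero_of_mul_eq_sum_mul J ℓ (e j₁) (fun i hi ↦ ?_) ?_ hΩ₀o hfc hq₀
    hz₀ hz0
  · simpa [hτ] using h
  · rw [hdual i (Finset.mem_insert_of_mem hi) j₁ (Finset.mem_insert_self _ _),
      if_neg (ne_of_mem_of_not_mem hi hj₁)]
  · rw [hdual j₁ (Finset.mem_insert_self _ _) j₁ (Finset.mem_insert_self _ _), if_pos rfl]

end Literature.Geometry.Kaehler
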